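import Summits.QuantumFields.BalabanUV.T4Continuum.Support.NE3EnergyWeightedShapes
import Summits.QuantumFields.BalabanUV.T4Continuum.Support.LatticeSupInterpolation
import HarnessLib

/-!
# T⁴ programme, node NE3 — repair census G-ne3p1-g19-1, leaf E-SUP: SUP CONTROL OF THE T-E_w DIRECTION `Z` —
# (s-a) the uniform bound that T-E_w already gives, (s-b) mass + norm-modulus on the period torus

NE3 (node U1b) formalisation swarm `b2b-balaban-t4-ne3-formalise-*`, leaf seat `b2b-balaban-t4-ne3-formalise-leaf-01`
(gen 4), row **E-SUP** of `HOME/t4/formal/NE3/LEAVES.md` (typer v1.44; journal INTENT ∕ CLAIM l.13373; SHAPE note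
`HOME/t4/formal/NE3/Statements/E-SUP-SHAPE-v1.md`), owner skeleton `SKELETON-NE3-P1.md` v1.9 §4b, socket E-SUP:
«`‖Z‖_∞ ≤ s_k` with `s_k → 0` geometrically for the T-E_w pair `(u, Z)` — NOT implied by T-E_w».

WHY.  The consumer D-CRUDE-w brackets the two-level local action read-out with the sharp read-out
`NE3LocalReadoutSharp.abs_fineAction_vary_sub_le_sharp` (`‖X(b)‖ ≤ α` on the window): every `α`-term there multiplies
`Σ bondSq Z ≤ 4·#Pl·L^{2k}·energyNormW² = O(g N⁴)`, which does NOT decay in `k`; so the local rate needs a sup bound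
`α = s_k` with `s_k² = O(L^{−k})` (and a uniform `α ≤ 1` for `e^α − 1 ≤ 2α`).  Since `(u, Z)` is bound by `∃` inside
T-E_w (`NE3EnergyWeightedShapes.NE3EnergyRateW`), a sup statement is either a consequence of T-E_w's energy conjunct (the
UNIFORM bound, §1 — k-free, `O(√g N²)`, NO rate: the owner's «NOT implied» made quantitative) or needs ONE MORE conjunct
on the same `Z`.  THIS FILE (0 `def`, 0 `sorry`) proves both halves generically:

§1 (s-a) PERIODIC SUP ≤ ℓ² IN THE WEIGHTED CURRENCY: for an `M`-periodic direction `Z` and EVERY site `x`,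
   `‖Z x κ‖² ≤ dirSq Z (periodBox M)`, **`‖Z x κ‖ ≤ L^k · energyNormW L k W Z (periodBox M)`**; hence from
   `energyNormW … ≤ C·residualScale d L N b g k`: `‖Z‖_∞ ≤ C·L^k·residualScale`, and at `d = 4`
   `L^k·residualScale 4 L N b g k = wallConst·N²·(√g·dualC2∕L + 2b²·dualC1∕L^{k+4}) ≤ wallConst·N²·(√g·dualC2∕L + 2b²·dualC1∕L⁵)`
   (`k ≥ 1`) — k-FREE, no decay (`norm_le_uniform_four`).
§2 (s-b) SUP FROM MASS AND NORM-MODULUS ON THE PERIOD TORUS: under the hypothesis SHAPE (a binder, asserted for nothing)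
   `(NM_λ) ∀ x ν κ, |‖Z (x + e ν) κ‖ − ‖Z x κ‖| ≤ λ` and `r + 1 ≤ M`:
   **`‖Z x κ‖ ≤ d·r·λ + √(dirSq Z (periodBox M)) ∕ √((r+1)^d)`** — E6 `LatticeSupInterpolation.abs_le_modulus_add_mass`
   BY NAME on the anchored box `Icc x (x + r·𝟙)`, the mass moved into one period by `sum_periodBox_shift`.
§3 THE WEIGHTED DICTIONARY: `√dirSq ≤ L^k·E_w`; block side `r + 1 = L^k` (admissible iff `N ≥ 1`); at `d = 4`
   **`‖Z x κ‖ ≤ 4·L^k·λ + E_w ∕ L^k`**, and with a modulus of (9)-TYPE size in lattice units `λ = Λ∕(L^k)²`: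
   `‖Z‖_∞ ≤ (4Λ + E_w)∕L^k` — geometric (`norm_le_div_pow_of_scaledModulus_four`); in the consumer's display (owner RULING
   l.13447, T-E_w♯'s conjunct `‖Z x κ‖ ≤ s·(L⁻¹)^k`): **`norm_le_supConst_mul_inv_pow_four`**, k-free `s = 4Λ + C·wallConst·N²·(…)`.
§4 THE MODULUS IS TYPED ON `‖Z‖`: it follows from a plain step-Lipschitz bound on `Z` AND from a unitarily TRANSPORTED one
   (`‖T·Z(x+e_ν,κ)·T⋆ − Z(x,κ)‖ ≤ λ`) — invariant under the simultaneous gauge action `Z(b) ↦ v·Z(b)·v⋆`, unlike the plain one.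

HONEST FRAMING.  Generic lattice counting at ONE direction field + bookkeeping in the η-weighted currency ([folklore]);
`(NM_λ)` is a HYPOTHESIS SHAPE (printed context only: [Balaban1985Variational] Thm 1 (9) p. 279 — regularity of the
gauge-fixed minimiser; as a statement about the pair it is UNPRINTED and NOT implied by the cell's `RegularSup` without a
gauge-fixing theorem); NOTHING about Bałaban's minimisers is proved; T-E_w ∕ (ML_w) ∕ (RES♯) NOT proved; **NE3 is NOT
proved**; spine PROVED 0∕9; finite T⁴ rung (B)+1 — NOT infinite volume, NOT mass gap, NOT `BetaPertH`, NOT Clay, NOT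
summit progress.  PLACEMENT (human rule 2026-08-19): `Summits/QuantumFields/BalabanUV/`.  HONEST DEPENDENCY (cell page 1):
continuum YM on T⁴ ⇐ BetaPertH ∧ nine spine estimates (0/9 proved); BetaPertH ⇐ (D1) ∧ (D4) ∧ CAP+tail; G-an2-4 gates
asym, D1 and NE2/3/4.
-/

set_option autoImplicit false

open scoped BigOperators Matrix Matrix.Norms.L2Operator
open Finset

namespace Summit.QuantumFields.BalabanUV.T4Continuum.NE3SupControl

open Literature.MathematicalPhysics.QuantumFieldTheory.Balaban1983to89
open B7Prop1Explicit
open T4AveragingDeficitWall hiding Site Plane Plaq Bond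
open T4AveragingDeficitWallBoundary (periodBox mem_periodBox sum_periodBox_shift)
open AveragingDeficitPeriodicCounting (IsPeriodicDir)
open AveragingDeficitDerivWallProof (wallConst wallConst_nonneg)
open AveragingDeficitDualResidual (dualC1 dualC2)
open NE3EnergyShapes (residualScale residualScale_nonneg dualC1_nonneg dualC2_nonneg)
open NE3EnergyWeightedShapes (energyNormW energyNormW_nonneg weighted_sqrt_dirSq_le_energyNormW)
open LatticeSupInterpolation (anchoredBox abs_le_modulus_add_mass)

noncomputable section

variable {d : ℕ} {n : Type*} [Fintype n] [DecidableEq n]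

/-! ## §1 (s-a) Periodic sup ≤ ℓ², in the weighted currency -/

/-- **PERIODIC SUP ≤ ℓ² AT EVERY SITE**: for an `M`-periodic direction `Z` (`M ≥ 1`), every site `x` (not only
`x ∈ periodBox M`) and every `κ`: `‖Z x κ‖² ≤ dirSq Z (periodBox M)` (the `x`-shifted period sum is the period sum).
[folklore] -/
theorem norm_sq_le_dirSq_of_periodic {M : ℕ} (hM : 1 ≤ M) {Z : Site d → Fin d → Matrix n n ℂ}
    (hZ : IsPeriodicDir Z (M : ℤ)) (x : Site d) (κ : Fin d) : ‖Z x κ‖ ^ 2 ≤ dirSq Z (periodBox M) := by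
  have hg : ∀ (y : Site d) (ν : Fin d), (fun y => ∑ μ : Fin d, ‖Z y μ‖ ^ 2) (y + (M : ℤ) • e ν)
      = (fun y => ∑ μ : Fin d, ‖Z y μ‖ ^ 2) y := fun y ν => by simp only [hZ y ν]
  have hshift := sum_periodBox_shift M hM (g := fun y => ∑ μ : Fin d, ‖Z y μ‖ ^ 2) hg x
  have h0 : (0 : Site d) ∈ periodBox (d := d) M :=
    mem_periodBox.mpr fun _ => ⟨le_rfl, by simp only [Pi.zero_apply]; exact_mod_cast (by omega : 0 < M)⟩
  calc ‖Z x κ‖ ^ 2 ≤ ∑ μ : Fin d, ‖Z x μ‖ ^ 2 :=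
        Finset.single_le_sum (f := fun μ => ‖Z x μ‖ ^ 2) (fun _ _ => sq_nonneg _) (Finset.mem_univ κ)
    _ = (fun y => ∑ μ : Fin d, ‖Z y μ‖ ^ 2) ((0 : Site d) + x) := by simp only [zero_add]
    _ ≤ ∑ y ∈ periodBox M, (fun y => ∑ μ : Fin d, ‖Z y μ‖ ^ 2) (y + x) :=
        Finset.single_le_sum (f := fun y => (fun y => ∑ μ : Fin d, ‖Z y μ‖ ^ 2) (y + x))
          (fun _ _ => Finset.sum_nonneg fun _ _ => sq_nonneg _) h0
    _ = dirSq Z (periodBox M) := by rw [hshift]; rfl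

/-- … in root form: `‖Z x κ‖ ≤ √(dirSq Z (periodBox M))`. [folklore] -/
theorem norm_le_sqrt_dirSq_of_periodic {M : ℕ} (hM : 1 ≤ M) {Z : Site d → Fin d → Matrix n n ℂ}
    (hZ : IsPeriodicDir Z (M : ℤ)) (x : Site d) (κ : Fin d) : ‖Z x κ‖ ≤ Real.sqrt (dirSq Z (periodBox M)) :=
  Real.le_sqrt_of_sq_le (norm_sq_le_dirSq_of_periodic hM hZ x κ)

/-- **THE UNIFORM SUP BOUND OF THE WEIGHTED CURRENCY**: for `L ≥ 1`, an `M`-periodic `Z` (`M ≥ 1`), every background `W`,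
every site `x` and every `κ`: `‖Z x κ‖ ≤ L^k · energyNormW L k W Z (periodBox M)` (the weight `(L^k)⁻²` sits on
`dirSq`). [folklore] -/
theorem norm_le_pow_mul_energyNormW {L : ℕ} (hL : 1 ≤ L) (k : ℕ) (W : Site d → Fin d → (Matrix n n ℂ)ˣ) {M : ℕ}
    (hM : 1 ≤ M) {Z : Site d → Fin d → Matrix n n ℂ} (hZ : IsPeriodicDir Z (M : ℤ)) (x : Site d) (κ : Fin d) :
    ‖Z x κ‖ ≤ (L : ℝ) ^ k * energyNormW L k W Z (periodBox M) := by
  have hLk : (0 : ℝ) < (L : ℝ) ^ k := pow_pos (by exact_mod_cast (by omega : 0 < L)) k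
  have h2 := weighted_sqrt_dirSq_le_energyNormW hL k W Z (periodBox M)
  have h3 : Real.sqrt (dirSq Z (periodBox M)) ≤ (L : ℝ) ^ k * energyNormW L k W Z (periodBox M) := by
    have := mul_le_mul_of_nonneg_left h2 hLk.le
    rwa [← mul_assoc, mul_inv_cancel₀ hLk.ne', one_mul] at this
  exact (norm_le_sqrt_dirSq_of_periodic hM hZ x κ).trans h3

/-- **(s-a) FROM T-E_w's ENERGY CONJUNCT**: if `energyNormW L k W Z (periodBox M) ≤ C·residualScale d L N b g k` then
`‖Z x κ‖ ≤ C·(L^k·residualScale d L N b g k)` at every site. [folklore] -/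
theorem norm_le_of_energyNormW_le_residualScale {L : ℕ} (hL : 1 ≤ L) {k : ℕ} {W : Site d → Fin d → (Matrix n n ℂ)ˣ}
    {M : ℕ} (hM : 1 ≤ M) {Z : Site d → Fin d → Matrix n n ℂ} (hZ : IsPeriodicDir Z (M : ℤ)) {N : ℕ} {b g C : ℝ}
    (hE : energyNormW L k W Z (periodBox M) ≤ C * residualScale d L N b g k) (x : Site d) (κ : Fin d) :
    ‖Z x κ‖ ≤ C * ((L : ℝ) ^ k * residualScale d L N b g k) := by
  have hLk : (0 : ℝ) ≤ (L : ℝ) ^ k := by positivity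
  calc ‖Z x κ‖ ≤ (L : ℝ) ^ k * energyNormW L k W Z (periodBox M) := norm_le_pow_mul_energyNormW hL k W hM hZ x κ
    _ ≤ (L : ℝ) ^ k * (C * residualScale d L N b g k) := mul_le_mul_of_nonneg_left hE hLk
    _ = C * ((L : ℝ) ^ k * residualScale d L N b g k) := by ring

omit [Fintype n] [DecidableEq n] in
/-- **THE RESIDUAL SCALE TIMES `L^k` AT `d = 4`, EXACTLY**: `L^k·residualScale 4 L N b g k
= wallConst 4 L·N²·(√g·dualC2 4 L ∕ L + 2b²·dualC1 4 L ∕ L^{k+4})` (`L ≥ 1`). [folklore] -/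
theorem pow_mul_residualScale_four_eq {L : ℕ} (hL : 1 ≤ L) (N : ℕ) (b g : ℝ) (k : ℕ) :
    (L : ℝ) ^ k * residualScale 4 L N b g k
      = wallConst 4 L * (N : ℝ) ^ 2
          * (Real.sqrt g * dualC2 4 L / L + 2 * b ^ 2 * dualC1 4 L / (L : ℝ) ^ (k + 4)) := by
  have hL0 : (0 : ℝ) < L := by exact_mod_cast (by omega : 0 < L)
  have hs1 : Real.sqrt (g * (N : ℝ) ^ 4 * ((L : ℝ) ^ (k + 1)) ^ 4 / ((L : ℝ) ^ (k + 1)) ^ 6)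
      = Real.sqrt g * ((N : ℝ) ^ 2 / (L : ℝ) ^ (k + 1)) := by
    have hq : (N : ℝ) ^ 4 * ((L : ℝ) ^ (k + 1)) ^ 4 / ((L : ℝ) ^ (k + 1)) ^ 6
        = ((N : ℝ) ^ 2 / (L : ℝ) ^ (k + 1)) ^ 2 := by
      field_simp
    rw [show g * (N : ℝ) ^ 4 * ((L : ℝ) ^ (k + 1)) ^ 4 / ((L : ℝ) ^ (k + 1)) ^ 6
        = g * ((N : ℝ) ^ 4 * ((L : ℝ) ^ (k + 1)) ^ 4 / ((L : ℝ) ^ (k + 1)) ^ 6) by ring, hq,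
      Real.sqrt_mul' g (sq_nonneg _), Real.sqrt_sq (by positivity)]
  have hs2 : Real.sqrt ((4 : ℕ) * (((N * L ^ k : ℕ) : ℝ)) ^ 4) = 2 * ((N : ℝ) * (L : ℝ) ^ k) ^ 2 := by
    rw [show ((4 : ℕ) : ℝ) * (((N * L ^ k : ℕ) : ℝ)) ^ 4 = (2 * ((N : ℝ) * (L : ℝ) ^ k) ^ 2) ^ 2 by push_cast; ring]
    exact Real.sqrt_sq (by positivity)
  unfold NE3EnergyShapes.residualScale
  rw [hs1, hs2]
  simp only [Nat.cast_ofNat, sub_self, zpow_zero, one_mul]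
  field_simp
  ring

omit [Fintype n] [DecidableEq n] in
/-- … hence for `k ≥ 1`: `L^k·residualScale 4 L N b g k ≤ wallConst 4 L·N²·(√g·dualC2 4 L ∕ L + 2b²·dualC1 4 L ∕ L⁵)` —
k-FREE: the weighted energy conjunct of T-E_w ALONE bounds `‖Z‖_∞` by `O(√g·N²)` and gives NO rate. [folklore] -/
theorem pow_mul_residualScale_four_le {L : ℕ} (hL : 1 ≤ L) (N : ℕ) (b g : ℝ) {k : ℕ} (hk : 1 ≤ k) :
    (L : ℝ) ^ k * residualScale 4 L N b g k
      ≤ wallConst 4 L * (N : ℝ) ^ 2 * (Real.sqrt g * dualC2 4 L / L + 2 * b ^ 2 * dualC1 4 L / (L : ℝ) ^ 5) := by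
  rw [pow_mul_residualScale_four_eq hL N b g k]
  have hW := wallConst_nonneg 4 L
  have hL1 : (1 : ℝ) ≤ L := by exact_mod_cast hL
  have hmono : 2 * b ^ 2 * dualC1 4 L / (L : ℝ) ^ (k + 4) ≤ 2 * b ^ 2 * dualC1 4 L / (L : ℝ) ^ 5 := by
    refine div_le_div_of_nonneg_left (by have := dualC1_nonneg 4 L; positivity) (by positivity) ?_
    exact pow_le_pow_right₀ hL1 (by omega)
  have hN2 : 0 ≤ wallConst 4 L * (N : ℝ) ^ 2 := by positivity
  nlinarith

/-- **(s-a) THE UNIFORM SUP BOUND AT `d = 4`**: for `L ≥ 1`, `k ≥ 1`, `C ≥ 0`, an `M`-periodic `Z` with T-E_w's conjunct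
`energyNormW L k W Z (periodBox M) ≤ C·residualScale 4 L N b g k`:
`‖Z x κ‖ ≤ C·wallConst 4 L·N²·(√g·dualC2 4 L ∕ L + 2b²·dualC1 4 L ∕ L⁵)` at every site — k-free, NO decay. [folklore] -/
theorem norm_le_uniform_four {L : ℕ} (hL : 1 ≤ L) {k : ℕ} (hk : 1 ≤ k) {W : Site 4 → Fin 4 → (Matrix n n ℂ)ˣ}
    {M : ℕ} (hM : 1 ≤ M) {Z : Site 4 → Fin 4 → Matrix n n ℂ} (hZ : IsPeriodicDir Z (M : ℤ)) {N : ℕ} {b g C : ℝ}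
    (hC : 0 ≤ C) (hE : energyNormW L k W Z (periodBox M) ≤ C * residualScale 4 L N b g k) (x : Site 4) (κ : Fin 4) :
    ‖Z x κ‖ ≤ C * (wallConst 4 L * (N : ℝ) ^ 2 * (Real.sqrt g * dualC2 4 L / L + 2 * b ^ 2 * dualC1 4 L / (L : ℝ) ^ 5)) :=
  (norm_le_of_energyNormW_le_residualScale hL hM hZ hE x κ).trans
    (mul_le_mul_of_nonneg_left (pow_mul_residualScale_four_le hL N b g hk) hC)

/-! ## §2 (s-b) Sup from mass and norm-modulus on the period torus -/

/-- THE MASS OF AN ANCHORED BOX IS AT MOST ONE PERIOD'S: for an `M`-periodic `Z` and `r + 1 ≤ M`, every anchor `x₀` and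
every `κ`: `Σ_{y ∈ Icc x₀ (x₀ + r·𝟙)} ‖Z y κ‖² ≤ dirSq Z (periodBox M)` (the box, translated by `−x₀`, lies in one period;
the period sum is shift-invariant). [folklore] -/
theorem sum_anchoredBox_le_dirSq {M r : ℕ} (hr : r + 1 ≤ M) {Z : Site d → Fin d → Matrix n n ℂ}
    (hZ : IsPeriodicDir Z (M : ℤ)) (x₀ : Site d) (κ : Fin d) :
    ∑ y ∈ anchoredBox x₀ r, ‖Z y κ‖ ^ 2 ≤ dirSq Z (periodBox M) := by
  have hM : 1 ≤ M := by omega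
  have hgp : ∀ y ν, (fun y => ‖Z y κ‖ ^ 2) (y + (M : ℤ) • e ν) = (fun y => ‖Z y κ‖ ^ 2) y := fun y ν => by simp only [hZ y ν κ]
  have hinj : Set.InjOn (fun y : Site d => y - x₀) ↑(anchoredBox x₀ r) := fun a _ b _ h => sub_left_injective h
  have hre : ∑ y ∈ anchoredBox x₀ r, ‖Z y κ‖ ^ 2
      = ∑ z ∈ (anchoredBox x₀ r).image (fun y => y - x₀), (fun y => ‖Z y κ‖ ^ 2) (z + x₀) := by
    rw [Finset.sum_image hinj]; simp only [sub_add_cancel]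
  have hsub : (anchoredBox x₀ r).image (fun y => y - x₀) ⊆ periodBox M := by
    intro z hz
    obtain ⟨y, hy, rfl⟩ := Finset.mem_image.mp hz
    have hy' : x₀ ≤ y ∧ y ≤ x₀ + fun _ => (r : ℤ) := by
      simpa [LatticeSupInterpolation.anchoredBox, Finset.mem_Icc] using hy
    refine mem_periodBox.mpr fun ι => ?_
    have h1 : x₀ ι ≤ y ι := hy'.1 ι
    have h2 : y ι ≤ x₀ ι + (r : ℤ) := hy'.2 ι
    simp only [Pi.sub_apply]; constructor <;> omega
  rw [hre]
  calc ∑ z ∈ (anchoredBox x₀ r).image (fun y => y - x₀), (fun y => ‖Z y κ‖ ^ 2) (z + x₀)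
      ≤ ∑ z ∈ periodBox M, (fun y => ‖Z y κ‖ ^ 2) (z + x₀) :=
        Finset.sum_le_sum_of_subset_of_nonneg hsub fun _ _ _ => sq_nonneg _
    _ = ∑ z ∈ periodBox M, (fun y => ‖Z y κ‖ ^ 2) z := sum_periodBox_shift M hM (g := fun y => ‖Z y κ‖ ^ 2) hgp x₀
    _ ≤ dirSq Z (periodBox M) := by
        unfold dirSq
        exact Finset.sum_le_sum fun z _ =>
          Finset.single_le_sum (f := fun μ => ‖Z z μ‖ ^ 2) (fun _ _ => sq_nonneg _) (Finset.mem_univ κ)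

/-- `m` LATTICE STEPS IN ONE DIRECTION MOVE THE NORM BY AT MOST `m·λ` under the norm modulus `(NM_λ)`. [folklore] -/
theorem abs_norm_sub_norm_le_steps {Z : Site d → Fin d → Matrix n n ℂ} {lam : ℝ}
    (hmod : ∀ (x : Site d) (ν κ : Fin d), |‖Z (x + e ν) κ‖ - ‖Z x κ‖| ≤ lam) (x : Site d) (ν κ : Fin d) :
    ∀ m : ℕ, |‖Z (x + (m : ℤ) • e ν) κ‖ - ‖Z x κ‖| ≤ m * lam
  | 0 => by simp
  | m + 1 => by
    have ih := abs_norm_sub_norm_le_steps hmod x ν κ m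
    have h1 := hmod (x + (m : ℤ) • e ν) ν κ
    have heq : x + ((m + 1 : ℕ) : ℤ) • e ν = x + (m : ℤ) • e ν + e ν := by
      rw [Nat.cast_succ, add_smul, one_smul, add_assoc]
    rw [heq]
    calc |‖Z (x + (m : ℤ) • e ν + e ν) κ‖ - ‖Z x κ‖|
        ≤ |‖Z (x + (m : ℤ) • e ν + e ν) κ‖ - ‖Z (x + (m : ℤ) • e ν) κ‖|
            + |‖Z (x + (m : ℤ) • e ν) κ‖ - ‖Z x κ‖| := abs_sub_le _ _ _
      _ ≤ lam + m * lam := add_le_add h1 ih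
      _ = ((m + 1 : ℕ) : ℝ) * lam := by push_cast; ring

/-- A LATTICE PATH WITH `m_ν` STEPS IN THE DIRECTIONS `ν ∈ s` MOVES THE NORM BY AT MOST `λ·Σ_{ν∈s} m_ν`. [folklore] -/
theorem abs_norm_sub_norm_le_sum {Z : Site d → Fin d → Matrix n n ℂ} {lam : ℝ}
    (hmod : ∀ (x : Site d) (ν κ : Fin d), |‖Z (x + e ν) κ‖ - ‖Z x κ‖| ≤ lam) (x : Site d) (κ : Fin d)
    (m : Fin d → ℕ) (s : Finset (Fin d)) :
    |‖Z (x + ∑ ν ∈ s, (m ν : ℤ) • e ν) κ‖ - ‖Z x κ‖| ≤ lam * ∑ ν ∈ s, (m ν : ℝ) := by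
  classical
  induction s using Finset.induction_on with
  | empty => simp
  | insert ν s hν ih =>
    rw [Finset.sum_insert hν, Finset.sum_insert hν, add_comm ((m ν : ℤ) • e ν), ← add_assoc, mul_add]
    have hstep := abs_norm_sub_norm_le_steps hmod (x + ∑ μ ∈ s, (m μ : ℤ) • e μ) ν κ (m ν)
    calc |‖Z (x + ∑ μ ∈ s, (m μ : ℤ) • e μ + (m ν : ℤ) • e ν) κ‖ - ‖Z x κ‖|
        ≤ |‖Z (x + ∑ μ ∈ s, (m μ : ℤ) • e μ + (m ν : ℤ) • e ν) κ‖ - ‖Z (x + ∑ μ ∈ s, (m μ : ℤ) • e μ) κ‖|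
            + |‖Z (x + ∑ μ ∈ s, (m μ : ℤ) • e μ) κ‖ - ‖Z x κ‖| := abs_sub_le _ _ _
      _ ≤ (m ν : ℝ) * lam + lam * ∑ μ ∈ s, (m μ : ℝ) := add_le_add hstep ih
      _ = lam * (m ν : ℝ) + lam * ∑ μ ∈ s, (m μ : ℝ) := by ring

/-- THE LOWER MODULUS ON THE ANCHORED BOX: under `(NM_λ)` with `λ ≥ 0`, for `y ∈ Icc x₀ (x₀ + r·𝟙)`:
`‖Z x₀ κ‖ − d·r·λ ≤ ‖Z y κ‖` (a lattice path of at most `d·r` steps joins `x₀` to `y`). [folklore] -/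
theorem norm_sub_le_norm_of_mem_anchoredBox {Z : Site d → Fin d → Matrix n n ℂ} {lam : ℝ} (hlam : 0 ≤ lam)
    (hmod : ∀ (x : Site d) (ν κ : Fin d), |‖Z (x + e ν) κ‖ - ‖Z x κ‖| ≤ lam) {x₀ y : Site d} {r : ℕ}
    (hy : y ∈ anchoredBox x₀ r) (κ : Fin d) : ‖Z x₀ κ‖ - d * r * lam ≤ ‖Z y κ‖ := by
  have hy' : x₀ ≤ y ∧ y ≤ x₀ + fun _ => (r : ℤ) := by
    simpa [LatticeSupInterpolation.anchoredBox, Finset.mem_Icc] using hy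
  obtain ⟨h1, h2⟩ := hy'
  set m : Fin d → ℕ := fun ν => (y ν - x₀ ν).toNat with hm
  have hmν : ∀ ν, ((m ν : ℕ) : ℤ) = y ν - x₀ ν := fun ν => by
    have a : x₀ ν ≤ y ν := h1 ν
    simp only [hm]; omega
  have hmle : ∀ ν, (m ν : ℝ) ≤ r := fun ν => by
    have a : x₀ ν ≤ y ν := h1 ν
    have b2 : y ν ≤ x₀ ν + (r : ℤ) := h2 ν
    have : m ν ≤ r := by simp only [hm]; omega
    exact_mod_cast this
  have hyeq : y = x₀ + ∑ ν : Fin d, (m ν : ℤ) • e ν := by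
    funext ι
    simp only [Pi.add_apply, Finset.sum_apply, Pi.smul_apply, smul_eq_mul, e_apply, mul_ite, mul_one, mul_zero,
      Finset.sum_ite_eq, Finset.mem_univ, if_true, hmν]
    ring
  have key := abs_norm_sub_norm_le_sum hmod x₀ κ m Finset.univ
  rw [← hyeq] at key
  have hsum : lam * ∑ ν : Fin d, (m ν : ℝ) ≤ d * r * lam := by
    calc lam * ∑ ν : Fin d, (m ν : ℝ) ≤ lam * ∑ _ν : Fin d, (r : ℝ) :=
          mul_le_mul_of_nonneg_left (Finset.sum_le_sum fun ν _ => hmle ν) hlam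
      _ = d * r * lam := by rw [Finset.sum_const, Finset.card_univ, Fintype.card_fin, nsmul_eq_mul]; ring
  linarith [(abs_sub_le_iff.mp (key.trans hsum)).2]

/-- **(s-b) SUP FROM MASS AND NORM-MODULUS ON THE PERIOD TORUS.**  For an `M`-periodic direction `Z` with the norm
modulus `(NM_λ)` (`λ ≥ 0`) and any box side `r + 1 ≤ M`, at EVERY site:
`‖Z x κ‖ ≤ d·r·λ + √(dirSq Z (periodBox M)) ∕ √((r+1)^d)` — E6 `LatticeSupInterpolation.abs_le_modulus_add_mass` on
the anchored box with weight `1` and mass `√dirSq`. [folklore] -/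
theorem norm_le_modulus_add_mass_periodic {M : ℕ} {Z : Site d → Fin d → Matrix n n ℂ} (hZ : IsPeriodicDir Z (M : ℤ))
    {lam : ℝ} (hlam : 0 ≤ lam) (hmod : ∀ (x : Site d) (ν κ : Fin d), |‖Z (x + e ν) κ‖ - ‖Z x κ‖| ≤ lam)
    {r : ℕ} (hr : r + 1 ≤ M) (x : Site d) (κ : Fin d) :
    ‖Z x κ‖ ≤ d * r * lam + Real.sqrt (dirSq Z (periodBox M)) / Real.sqrt (((r : ℝ) + 1) ^ d) := by
  have hmod' : ∀ y ∈ anchoredBox x r, |(fun y => ‖Z y κ‖) x| - d * r * lam ≤ |(fun y => ‖Z y κ‖) y| :=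
    fun y hy => by simpa only [abs_norm] using norm_sub_le_norm_of_mem_anchoredBox hlam hmod hy κ
  have hmass : (1 : ℝ) * ∑ y ∈ anchoredBox x r, (fun y => ‖Z y κ‖) y ^ 2 ≤ Real.sqrt (dirSq Z (periodBox M)) ^ 2 := by
    rw [one_mul, Real.sq_sqrt (by unfold dirSq; positivity)]
    exact sum_anchoredBox_le_dirSq hr hZ x κ
  have h := abs_le_modulus_add_mass x r (fun y => ‖Z y κ‖) hmod' one_pos (Real.sqrt_nonneg _) hmass
  simpa only [abs_norm, one_mul] using h

/-! ## §3 The weighted dictionary -/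

/-- **(s-b), WEIGHTED**: with `√dirSq ≤ L^k·energyNormW` (`L ≥ 1`), for an `M`-periodic `Z` with `(NM_λ)` and `r + 1 ≤ M`:
`‖Z x κ‖ ≤ d·r·λ + L^k·energyNormW L k W Z (periodBox M) ∕ √((r+1)^d)`. [folklore] -/
theorem norm_le_modulus_add_energyNormW {L : ℕ} (hL : 1 ≤ L) (k : ℕ) (W : Site d → Fin d → (Matrix n n ℂ)ˣ)
    {M : ℕ} {Z : Site d → Fin d → Matrix n n ℂ} (hZ : IsPeriodicDir Z (M : ℤ)) {lam : ℝ} (hlam : 0 ≤ lam)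
    (hmod : ∀ (x : Site d) (ν κ : Fin d), |‖Z (x + e ν) κ‖ - ‖Z x κ‖| ≤ lam) {r : ℕ} (hr : r + 1 ≤ M)
    (x : Site d) (κ : Fin d) :
    ‖Z x κ‖ ≤ d * r * lam + (L : ℝ) ^ k * energyNormW L k W Z (periodBox M) / Real.sqrt (((r : ℝ) + 1) ^ d) := by
  have hLk : (0 : ℝ) < (L : ℝ) ^ k := pow_pos (by exact_mod_cast (by omega : 0 < L)) k
  have h2 := weighted_sqrt_dirSq_le_energyNormW hL k W Z (periodBox M)
  have h3 : Real.sqrt (dirSq Z (periodBox M)) ≤ (L : ℝ) ^ k * energyNormW L k W Z (periodBox M) := by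
    have := mul_le_mul_of_nonneg_left h2 hLk.le
    rwa [← mul_assoc, mul_inv_cancel₀ hLk.ne', one_mul] at this
  exact (norm_le_modulus_add_mass_periodic hZ hlam hmod hr x κ).trans
    (by linarith [div_le_div_of_nonneg_right h3 (Real.sqrt_nonneg (((r : ℝ) + 1) ^ d))])

/-- **(s-b) AT `d = 4` WITH BLOCK SIDE `L^k`**: for `L ≥ 1`, `N ≥ 1`, an `(N·L^k)`-periodic `Z` with `(NM_λ)` (`λ ≥ 0`):
`‖Z x κ‖ ≤ 4·L^k·λ + energyNormW L k W Z (periodBox (N·L^k)) ∕ L^k` at every site (`r + 1 = L^k ≤ N·L^k`,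
`√(L^{4k}) = L^{2k}`). [folklore] -/
theorem norm_le_of_modulus_energyNormW_four {L N : ℕ} (hL : 1 ≤ L) (hN : 1 ≤ N) (k : ℕ)
    (W : Site 4 → Fin 4 → (Matrix n n ℂ)ˣ) {Z : Site 4 → Fin 4 → Matrix n n ℂ}
    (hZ : IsPeriodicDir Z ((N * L ^ k : ℕ) : ℤ)) {lam : ℝ} (hlam : 0 ≤ lam)
    (hmod : ∀ (x : Site 4) (ν κ : Fin 4), |‖Z (x + e ν) κ‖ - ‖Z x κ‖| ≤ lam) (x : Site 4) (κ : Fin 4) :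
    ‖Z x κ‖ ≤ 4 * (L : ℝ) ^ k * lam + energyNormW L k W Z (periodBox (N * L ^ k)) / (L : ℝ) ^ k := by
  have hL0 : 0 < L := by omega
  have hLk : 1 ≤ L ^ k := Nat.one_le_pow k L hL0
  have hLkR : (0 : ℝ) < (L : ℝ) ^ k := pow_pos (by exact_mod_cast hL0) k
  have hr : (L ^ k - 1) + 1 ≤ N * L ^ k := by
    rw [Nat.sub_add_cancel hLk]; exact Nat.le_mul_of_pos_left (L ^ k) (by omega)
  have h := norm_le_modulus_add_energyNormW hL k W hZ hlam hmod hr x κ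
  have hcast : ((L ^ k - 1 : ℕ) : ℝ) + 1 = (L : ℝ) ^ k := by
    rw [Nat.cast_sub hLk]; push_cast; ring
  have hsqrt : Real.sqrt ((((L ^ k - 1 : ℕ) : ℝ) + 1) ^ 4) = ((L : ℝ) ^ k) ^ 2 := by
    rw [hcast, show ((L : ℝ) ^ k) ^ 4 = (((L : ℝ) ^ k) ^ 2) ^ 2 by ring]
    exact Real.sqrt_sq (by positivity)
  rw [hsqrt] at h
  have h5 : ((4 : ℕ) : ℝ) * ((L ^ k - 1 : ℕ) : ℝ) ≤ 4 * (L : ℝ) ^ k := by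
    rw [Nat.cast_sub hLk]; push_cast; linarith
  have hstep := mul_le_mul_of_nonneg_right h5 hlam
  have hdiv : (L : ℝ) ^ k * energyNormW L k W Z (periodBox (N * L ^ k)) / ((L : ℝ) ^ k) ^ 2
      = energyNormW L k W Z (periodBox (N * L ^ k)) / (L : ℝ) ^ k := by
    rw [pow_two, mul_div_mul_left _ _ hLkR.ne']
  rw [hdiv] at h
  exact h.trans (add_le_add hstep le_rfl)

/-- **(s-b) AT `d = 4` WITH A MODULUS OF (9)-TYPE SIZE IN LATTICE UNITS** `λ = Λ ∕ (L^k)²` (`Λ ≥ 0`) and an energy bound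
`energyNormW … ≤ E`: `‖Z x κ‖ ≤ (4Λ + E) ∕ L^k` — GEOMETRIC decay of the sup. [folklore] -/
theorem norm_le_div_pow_of_scaledModulus_four {L N : ℕ} (hL : 1 ≤ L) (hN : 1 ≤ N) (k : ℕ)
    {W : Site 4 → Fin 4 → (Matrix n n ℂ)ˣ} {Z : Site 4 → Fin 4 → Matrix n n ℂ}
    (hZ : IsPeriodicDir Z ((N * L ^ k : ℕ) : ℤ)) {Λ : ℝ} (hΛ : 0 ≤ Λ)
    (hmod : ∀ (x : Site 4) (ν κ : Fin 4), |‖Z (x + e ν) κ‖ - ‖Z x κ‖| ≤ Λ / ((L : ℝ) ^ k) ^ 2) {E : ℝ}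
    (hE : energyNormW L k W Z (periodBox (N * L ^ k)) ≤ E) (x : Site 4) (κ : Fin 4) :
    ‖Z x κ‖ ≤ (4 * Λ + E) / (L : ℝ) ^ k := by
  have hLkR : (0 : ℝ) < (L : ℝ) ^ k := pow_pos (by exact_mod_cast (by omega : 0 < L)) k
  have hlam : 0 ≤ Λ / ((L : ℝ) ^ k) ^ 2 := by positivity
  have h := norm_le_of_modulus_energyNormW_four hL hN k W hZ hlam hmod x κ
  have h2 := div_le_div_of_nonneg_right hE hLkR.le
  have h1 : 4 * (L : ℝ) ^ k * (Λ / ((L : ℝ) ^ k) ^ 2) = 4 * Λ / (L : ℝ) ^ k := by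
    rw [← mul_div_assoc, pow_two, show 4 * (L : ℝ) ^ k * Λ = (L : ℝ) ^ k * (4 * Λ) by ring,
      mul_div_mul_left _ _ hLkR.ne']
  rw [h1] at h
  rw [add_div]; linarith

/-- **E-SUP DISCHARGED IN THE CONSUMER's DISPLAY (T-E_w♯'s extra conjunct, owner RULING l.13447)**: at `d = 4`, for
`L, N, k ≥ 1`, `C, Λ ≥ 0`, an `(N·L^k)`-periodic `Z` with the norm modulus `(NM_{Λ∕L^{2k}})` and T-E_w's energy conjunct
`energyNormW L k W Z (periodBox (N·L^k)) ≤ C·residualScale 4 L N b g k`: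
`‖Z x κ‖ ≤ s·(L⁻¹)^k` with the k-FREE `s = 4Λ + C·wallConst 4 L·N²·(√g·dualC2 4 L∕L + 2b²·dualC1 4 L∕L⁵)`. [folklore] -/
theorem norm_le_supConst_mul_inv_pow_four {L N k : ℕ} (hL : 1 ≤ L) (hN : 1 ≤ N) (hk : 1 ≤ k)
    {W : Site 4 → Fin 4 → (Matrix n n ℂ)ˣ} {Z : Site 4 → Fin 4 → Matrix n n ℂ}
    (hZ : IsPeriodicDir Z ((N * L ^ k : ℕ) : ℤ)) {Λ : ℝ} (hΛ : 0 ≤ Λ)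
    (hmod : ∀ (x : Site 4) (ν κ : Fin 4), |‖Z (x + e ν) κ‖ - ‖Z x κ‖| ≤ Λ / ((L : ℝ) ^ k) ^ 2) {b g C : ℝ}
    (hC : 0 ≤ C) (hE : energyNormW L k W Z (periodBox (N * L ^ k)) ≤ C * residualScale 4 L N b g k)
    (x : Site 4) (κ : Fin 4) :
    ‖Z x κ‖ ≤ (4 * Λ + C * (wallConst 4 L * (N : ℝ) ^ 2
        * (Real.sqrt g * dualC2 4 L / L + 2 * b ^ 2 * dualC1 4 L / (L : ℝ) ^ 5))) * ((L : ℝ)⁻¹) ^ k := by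
  have hL1 : (1 : ℝ) ≤ (L : ℝ) ^ k := one_le_pow₀ (by exact_mod_cast hL)
  have hLkR : (0 : ℝ) < (L : ℝ) ^ k := by positivity
  have h := norm_le_div_pow_of_scaledModulus_four hL hN k hZ hΛ hmod hE x κ
  have hrs := residualScale_nonneg 4 L N b g k
  have h1 : C * residualScale 4 L N b g k ≤ C * (wallConst 4 L * (N : ℝ) ^ 2
      * (Real.sqrt g * dualC2 4 L / L + 2 * b ^ 2 * dualC1 4 L / (L : ℝ) ^ 5)) := by
    refine mul_le_mul_of_nonneg_left (le_trans ?_ (pow_mul_residualScale_four_le hL N b g hk)) hC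
    exact le_mul_of_one_le_left hrs hL1
  rw [inv_pow, ← div_eq_mul_inv]
  exact h.trans (div_le_div_of_nonneg_right (by linarith) hLkR.le)

/-! ## §4 The norm modulus from a plain or a transported step-Lipschitz bound -/

omit [Fintype n] [DecidableEq n] in
/-- `(NM_λ)` FROM A PLAIN STEP-LIPSCHITZ BOUND: `‖Z(x+e_ν,κ) − Z(x,κ)‖ ≤ λ` for all `x ν κ` gives the norm modulus.
[folklore] -/
theorem normModulus_of_lipschitz {E : Type*} [SeminormedAddCommGroup E] {Z : Site d → Fin d → E} {lam : ℝ}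
    (h : ∀ (x : Site d) (ν κ : Fin d), ‖Z (x + e ν) κ - Z x κ‖ ≤ lam) (x : Site d) (ν κ : Fin d) :
    |‖Z (x + e ν) κ‖ - ‖Z x κ‖| ≤ lam :=
  (abs_norm_sub_norm_le _ _).trans (h x ν κ)

/-- UNITARY CONJUGATION IS AN ISOMETRY of `M_N(ℂ)` in the operator norm: `‖T·A·T⋆‖ = ‖A‖` for `T ∈ U(N)`. [folklore] -/
theorem norm_conj_unitary_eq {T : Matrix n n ℂ} (hT : T ∈ unitary (Matrix n n ℂ)) (A : Matrix n n ℂ) :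
    ‖T * A * star T‖ = ‖A‖ := by
  rw [CStarRing.norm_mul_mem_unitary _ (Unitary.star_mem hT), CStarRing.norm_mem_unitary_mul _ hT]

/-- `(NM_λ)` FROM A TRANSPORTED STEP-LIPSCHITZ BOUND: if for every `x ν κ` some unitary `T x ν κ` (e.g. the background's
parallel transporter `W(x+e_κ, ν)`) has `‖T·Z(x+e_ν,κ)·T⋆ − Z(x,κ)‖ ≤ λ`, then the norm modulus holds — the GAUGE-INVARIANT
form of the hypothesis (under the simultaneous gauge action on the pair, `Z(b) ↦ v·Z(b)·v⋆` bondwise: norms are invariant,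
plain differences are not). [folklore] -/
theorem normModulus_of_conj_lipschitz {Z : Site d → Fin d → Matrix n n ℂ} {T : Site d → Fin d → Fin d → Matrix n n ℂ}
    (hT : ∀ (x : Site d) (ν κ : Fin d), T x ν κ ∈ unitary (Matrix n n ℂ)) {lam : ℝ}
    (h : ∀ (x : Site d) (ν κ : Fin d), ‖T x ν κ * Z (x + e ν) κ * star (T x ν κ) - Z x κ‖ ≤ lam)
    (x : Site d) (ν κ : Fin d) : |‖Z (x + e ν) κ‖ - ‖Z x κ‖| ≤ lam := by
  rw [← norm_conj_unitary_eq (hT x ν κ) (Z (x + e ν) κ)]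
  exact (abs_norm_sub_norm_le _ _).trans (h x ν κ)

end

end Summit.QuantumFields.BalabanUV.T4Continuum.NE3SupControl
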